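import Literature.Geometry.Riemannian.MCFTranslationInvariance
import HarnessLib

/-!
# Isometry invariance of mean curvature flow; symmetric sets have symmetric level set flows

Topic `Literature/Geometry/Riemannian`. The Euclidean group acts on the tree's mean curvature flow
vocabulary (`IsClassicalMCF`, `IsWeakSetFlowIn`, `levelSetFlow` of `MeanConvexLevelSetFlow.lean`) of
`ℝⁿ⁺¹`: for a linear isometry `A` (Mathlib `LinearIsometryEquiv`) and an immersed hypersurface
`f` with normal `ν`, the pair `(A ∘ f, A ∘ ν)` has the same induced form, unit normal relation,
second fundamental form and mean curvature (`inducedBilin_isometry_comp`,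
`isUnitNormal_isometry_comp`, `secondFundamentalForm_isometry_comp`,
`meanCurvature_isometry_comp`; flat formulas of `EuclideanHypersurfaceContact.lean`), hence

* `IsClassicalMCF.isometry_comp` — classical mean curvature flows are mapped to classical mean
  curvature flows (translations: `IsClassicalMCF.add_const`, `MCFTranslationInvariance.lean`);
* `IsWeakSetFlowIn.image_isometry`, `IsWeakSetFlowIn.image_add_const` — weak set flows are mapped
  to weak set flows (test flows pull back under `A⁻¹`, `x ↦ x - v`);
* `levelSetFlow_image_isometry`, `levelSetFlow_image_add_const` — **the level set flow commutes
  with isometries**: `F_t(A K₀) = A F_t(K₀)`, `F_t(K₀ + v) = F_t(K₀) + v` (uniqueness of the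
  biggest flow); `levelSetFlow_image_eq_self` — **a set invariant under `A` has an `A`-invariant
  level set flow** (symmetry is preserved by the weak flow through singularities).

Everything is PROVED; no definitions, no named facts.

## References

* B. White, *The size of the singular set in mean curvature flow of mean-convex sets*, J. Amer.
  Math. Soc. 13 (2000), §2 (uniqueness and elementary properties of the level set flow).
  [White2000]
* O. Hershkovits, B. White, Comm. Pure Appl. Math. 73 (2020), Appendix, Def. 19.
  [HershkovitsWhite2019]
-/

noncomputable section

open Bundle Set Function Metric Module Filter
open scoped Manifold ContDiff Topology RealInnerProductSpace

namespace Literature.Geometry.Riemannian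

open Lorentzian Lorentzian.PseudoRiemannianMetric EuclideanHypersurface

/-! ### Linear isometries acting on immersed hypersurfaces of a Euclidean space -/

section Isometry

variable {E' : Type*} [NormedAddCommGroup E'] [NormedSpace ℝ E']
  {H' : Type*} [TopologicalSpace H'] {I' : ModelWithCorners ℝ E' H'}
  {N : Type*} [TopologicalSpace N] [ChartedSpace H' N]
  {V : Type*} [NormedAddCommGroup V] [InnerProductSpace ℝ V] (A : V ≃ₗᵢ[ℝ] V)

/-- The differential of `A ∘ f` for a linear isometry `A`: `d(A ∘ f)_x = A ∘ df_x`. [folklore] -/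
theorem hasMFDerivAt_isometry_comp {f : N → V} {x : N} (hf : MDifferentiableAt I' 𝓘(ℝ, V) f x) :
    HasMFDerivAt I' 𝓘(ℝ, V) (fun y ↦ A (f y)) x
      ((A : V →L[ℝ] V).comp (mfderiv I' 𝓘(ℝ, V) f x : TangentSpace I' x →L[ℝ] V)) :=
  (A : V →L[ℝ] V).hasFDerivAt.hasMFDerivAt.comp x hf.hasMFDerivAt

/-- Pointwise form: `d(A ∘ f)_x w = A (df_x w)`. [folklore] -/
theorem mfderiv_isometry_comp_apply {f : N → V} {x : N} (hf : MDifferentiableAt I' 𝓘(ℝ, V) f x)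
    (w : TangentSpace I' x) :
    (mfderiv I' 𝓘(ℝ, V) (fun y ↦ A (f y)) x : TangentSpace I' x →L[ℝ] V) w =
      A ((mfderiv I' 𝓘(ℝ, V) f x : TangentSpace I' x →L[ℝ] V) w) := by
  rw [(hasMFDerivAt_isometry_comp A hf).mfderiv]
  rfl

/-- The induced bilinear forms of `f` and `A ∘ f` agree. [folklore] -/
theorem inducedBilin_isometry_comp {f : N → V} (hf : ContMDiff I' 𝓘(ℝ, V) 1 f) (y : N)
    (u w : TangentSpace I' y) :
    (euclideanMetric V).inducedBilin I' (fun y ↦ A (f y)) y u w =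
      (euclideanMetric V).inducedBilin I' f y u w := by
  have hd : MDifferentiableAt I' 𝓘(ℝ, V) f y := (hf y).mdifferentiableAt one_ne_zero
  rw [inducedBilin_apply, inducedBilin_apply, euclideanMetric_apply, euclideanMetric_apply]
  have e₁ := mfderiv_isometry_comp_apply A hd u
  have e₂ := mfderiv_isometry_comp_apply A hd w
  change ⟪(mfderiv I' 𝓘(ℝ, V) (fun y ↦ A (f y)) y : TangentSpace I' y →L[ℝ] V) u,
      (mfderiv I' 𝓘(ℝ, V) (fun y ↦ A (f y)) y : TangentSpace I' y →L[ℝ] V) w⟫ =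
    ⟪(mfderiv I' 𝓘(ℝ, V) f y : TangentSpace I' y →L[ℝ] V) u,
      (mfderiv I' 𝓘(ℝ, V) f y : TangentSpace I' y →L[ℝ] V) w⟫
  rw [e₁, e₂]
  exact A.inner_map_map _ _

/-- **A linear isometry maps spacelike immersions to spacelike immersions** (the induced forms
agree). [folklore] -/
theorem isSpacelikeImmersion_isometry_comp {f : N → V}
    (hf : (euclideanMetric V).IsSpacelikeImmersion I' f) :
    (euclideanMetric V).IsSpacelikeImmersion I' (fun y ↦ A (f y)) := by
  refine ⟨(A : V →L[ℝ] V).contMDiff.comp hf.contMDiff, fun y w hw ↦ ?_⟩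
  rw [inducedBilin_isometry_comp A (hf.contMDiff.of_le (by simp)) y w w]
  exact hf.inducedBilin_pos y hw

/-- **A linear isometry maps unit normals to unit normals**: `A ∘ ν` is a unit normal of `A ∘ f`.
[folklore] -/
theorem isUnitNormal_isometry_comp {f ν : N → V} (hf : ContMDiff I' 𝓘(ℝ, V) 1 f)
    (hν : (euclideanMetric V).IsUnitNormal I' f ν 1) :
    (euclideanMetric V).IsUnitNormal I' (fun y ↦ A (f y)) (fun y ↦ A (ν y)) 1 := by
  refine ⟨fun y w ↦ ?_, fun y ↦ ?_⟩
  · have hd : MDifferentiableAt I' 𝓘(ℝ, V) f y := (hf y).mdifferentiableAt one_ne_zero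
    have h : ⟪ν y, (mfderiv I' 𝓘(ℝ, V) f y : TangentSpace I' y →L[ℝ] V) w⟫ = 0 :=
      hν.isNormalTo y w
    have e := mfderiv_isometry_comp_apply A hd w
    change ⟪A (ν y), (mfderiv I' 𝓘(ℝ, V) (fun y ↦ A (f y)) y : TangentSpace I' y →L[ℝ] V) w⟫ = 0
    rw [e]
    have h2 : ⟪A (ν y), A ((mfderiv I' 𝓘(ℝ, V) f y : TangentSpace I' y →L[ℝ] V) w)⟫ =
        ⟪ν y, (mfderiv I' 𝓘(ℝ, V) f y : TangentSpace I' y →L[ℝ] V) w⟫ := A.inner_map_map _ _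
    rw [h2]
    exact h
  · have h : ⟪ν y, ν y⟫ = (1 : ℝ) := hν.val_self y
    have h2 : ⟪A (ν y), A (ν y)⟫ = ⟪ν y, ν y⟫ := A.inner_map_map _ _
    change ⟪A (ν y), A (ν y)⟫ = (1 : ℝ)
    rw [h2]
    exact h

variable [FiniteDimensional ℝ E'] [I'.Boundaryless] [IsManifold I' ∞ N] [FiniteDimensional ℝ V]
  [(euclideanMetric V).HasLeviCivita]

/-- **The second fundamental form is invariant under linear isometries**: `K_{A∘f, A∘ν} = K_{f,ν}`
(`K(u, w) = ⟪dν u, df w⟫`). [folklore] -/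
theorem secondFundamentalForm_isometry_comp {f ν : N → V} (hf : ContMDiff I' 𝓘(ℝ, V) ∞ f)
    (hν : ContMDiff I' 𝓘(ℝ, V) ∞ ν) (y : N) (u w : TangentSpace I' y) :
    (euclideanMetric V).secondFundamentalForm I' (fun y ↦ A (f y)) (fun y ↦ A (ν y)) y u w =
      (euclideanMetric V).secondFundamentalForm I' f ν y u w := by
  have hdf : MDifferentiableAt I' 𝓘(ℝ, V) f y := (hf y).mdifferentiableAt (by simp)
  have hdν : MDifferentiableAt I' 𝓘(ℝ, V) ν y := (hν y).mdifferentiableAt (by simp)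
  have hf' : ContMDiff I' 𝓘(ℝ, V) ∞ (fun y ↦ A (f y)) := (A : V →L[ℝ] V).contMDiff.comp hf
  have hν' : ContMDiff I' 𝓘(ℝ, V) ∞ (fun y ↦ A (ν y)) := (A : V →L[ℝ] V).contMDiff.comp hν
  have h1 := secondFundamentalForm_eq_inner hf' hν' y u w
  have h2 := secondFundamentalForm_eq_inner hf hν y u w
  have eν := mfderiv_isometry_comp_apply A hdν u
  have ef := mfderiv_isometry_comp_apply A hdf w
  rw [h1, h2, eν, ef]
  exact A.inner_map_map _ _

/-- **The mean curvature is invariant under linear isometries**: `H_{A∘f, A∘ν} = H_{f,ν}`.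
[folklore] -/
theorem meanCurvature_isometry_comp {f ν : N → V} (hpb : contMDiff_pullbackBilin 𝓘(ℝ, V) V I' N ∞)
    (hf : (euclideanMetric V).IsSpacelikeImmersion I' f)
    (hf' : (euclideanMetric V).IsSpacelikeImmersion I' (fun y ↦ A (f y)))
    (hν : ContMDiff I' 𝓘(ℝ, V) ∞ ν) (y : N) :
    (euclideanMetric V).meanCurvature (fun y ↦ A (f y)) hpb hf' (fun y ↦ A (ν y)) y =
      (euclideanMetric V).meanCurvature f hpb hf ν y := by
  set g₁ := (euclideanMetric V).inducedMetric f hpb hf with hg₁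
  set g₂ := (euclideanMetric V).inducedMetric (fun y ↦ A (f y)) hpb hf' with hg₂
  have hval : ∀ u w : TangentSpace I' y, g₂.val y u w = g₁.val y u w := fun u w ↦ by
    rw [hg₁, hg₂, inducedMetric_val, inducedMetric_val]
    exact inducedBilin_isometry_comp A (hf.contMDiff_self.of_le (by simp)) y u w
  have hpos : ∀ u : TangentSpace I' y, u ≠ 0 → 0 < g₁.val y u u :=
    fun u hu ↦ isRiemannian_inducedMetric _ _ hpb hf y u hu
  obtain ⟨b, hb⟩ := g₁.exists_basis_isOrthonormalFrame hpos (m := finrank ℝ E') rfl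
  have hb' : g₂.IsOrthonormalFrame y b :=
    ⟨fun i ↦ by rw [hval]; exact hb.1 i, fun i j hij ↦ by rw [hval]; exact hb.2 i j hij⟩
  rw [meanCurvature, meanCurvature, g₂.trace_eq_sum_of_isOrthonormalFrame b hb',
    g₁.trace_eq_sum_of_isOrthonormalFrame b hb]
  exact Finset.sum_congr rfl fun i _ ↦
    secondFundamentalForm_isometry_comp A hf.contMDiff_self hν y (b i) (b i)

end Isometry

/-! ### Linear isometries and translations acting on classical and weak set flows of `ℝⁿ⁺¹` -/

section MCF

variable {n : ℕ} (A : EuclideanSpace ℝ (Fin (n + 1)) ≃ₗᵢ[ℝ] EuclideanSpace ℝ (Fin (n + 1)))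

/-- **Mean curvature flow in `ℝⁿ⁺¹` is invariant under linear isometries**: `(A ∘ F, A ∘ ν)` is a
classical mean curvature flow whenever `(F, ν)` is. [folklore] -/
theorem IsClassicalMCF.isometry_comp {N : Type*} [TopologicalSpace N]
    [ChartedSpace (EuclideanSpace ℝ (Fin n)) N] [IsManifold (𝓡 n) ∞ N]
    {F : ℝ → N → EuclideanSpace ℝ (Fin (n + 1))} {ν : (t : ℝ) → NormalField (𝓡 (n + 1)) (F t)}
    {a b : ℝ} (h : IsClassicalMCF (euclideanMetric (EuclideanSpace ℝ (Fin (n + 1)))) F ν a b) :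
    IsClassicalMCF (euclideanMetric (EuclideanSpace ℝ (Fin (n + 1)))) (fun t y ↦ A (F t y))
      (fun t y ↦ A (ν t y)) a b := by
  obtain ⟨U, hU, hIU, hF⟩ := h.contMDiffOn
  have hνs : ∀ t ∈ Icc a b, ContMDiff (𝓡 n) 𝓘(ℝ, EuclideanSpace ℝ (Fin (n + 1))) ∞ (ν t) :=
    fun t ht ↦ (contMDiff_of_contMDiff_lift (h.contMDiff_normal t ht)).2
  have hsp : ∀ t ∈ Icc a b, (euclideanMetric (EuclideanSpace ℝ (Fin (n + 1)))).IsSpacelikeImmersion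
      (𝓡 n) (fun y ↦ A (F t y)) :=
    fun t ht ↦ isSpacelikeImmersion_isometry_comp A (h.isSpacelikeImmersion t ht)
  have hA : ContMDiff 𝓘(ℝ, EuclideanSpace ℝ (Fin (n + 1))) 𝓘(ℝ, EuclideanSpace ℝ (Fin (n + 1))) ∞
      (fun x : EuclideanSpace ℝ (Fin (n + 1)) ↦ A x) :=
    (A : EuclideanSpace ℝ (Fin (n + 1)) →L[ℝ] EuclideanSpace ℝ (Fin (n + 1))).contMDiff
  refine
    { compactSpace := h.compactSpace
      contMDiffOn := ⟨U, hU, hIU, hA.comp_contMDiffOn hF⟩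
      isSpacelikeImmersion := hsp
      injective := fun t ht y₁ y₂ hy ↦ h.injective t ht (A.injective hy)
      isUnitNormal := fun t ht ↦ isUnitNormal_isometry_comp A
        ((h.isSpacelikeImmersion t ht).contMDiff_self.of_le (by simp)) (h.isUnitNormal t ht)
      contMDiff_normal := fun t ht ↦ contMDiff_lift_of_contMDiff
        (hA.comp (h.isSpacelikeImmersion t ht).contMDiff_self) (hA.comp (hνs t ht))
      velocity_eq := fun t ht y ↦ ?_ }
  -- velocity: `∂ₜ(A ∘ F) = A ∂ₜF = A(-H ν) = -H (A ν)`, and `H_{A∘F} = H_F`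
  have hd : MDifferentiableAt 𝓘(ℝ, ℝ) 𝓘(ℝ, EuclideanSpace ℝ (Fin (n + 1))) (fun s ↦ F s y) t :=
    ((contDiffAt_slice hU hF (hIU ht) y).differentiableAt (by simp)).mdifferentiableAt
  have e := mfderiv_isometry_comp_apply (I' := 𝓘(ℝ, ℝ)) A hd (1 : ℝ)
  rw [meanCurvature_isometry_comp A contMDiff_pullbackBilin_holds (h.isSpacelikeImmersion t ht)
    (hsp t ht) (hνs t ht) y]
  exact e.trans ((congrArg A (h.velocity_eq t ht y)).trans (A.map_smul _ _))

/-- **Weak set flows of `ℝⁿ⁺¹` are invariant under linear isometries**: `t ↦ A(K t)` is a weak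
set flow whenever `K` is (a classical flow testing `A(K)` pulls back under `A⁻¹` to one testing
`K`). [cite: HershkovitsWhite2019, Appendix Def. 19] -/
theorem IsWeakSetFlowIn.image_isometry {I : Set ℝ} {K : ℝ → Set (EuclideanSpace ℝ (Fin (n + 1)))}
    (hK : IsWeakSetFlowIn (euclideanMetric (EuclideanSpace ℝ (Fin (n + 1)))) univ I K) :
    IsWeakSetFlowIn (euclideanMetric (EuclideanSpace ℝ (Fin (n + 1)))) univ I fun t ↦ A '' K t := by
  obtain ⟨-, ⟨C, hC, htr⟩, havoid⟩ := hK
  have hmem : ∀ {x : EuclideanSpace ℝ (Fin (n + 1))} {S : Set (EuclideanSpace ℝ (Fin (n + 1)))},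
      x ∈ A '' S ↔ A.symm x ∈ S := fun {x S} ↦
    ⟨fun ⟨y, hy, hyx⟩ ↦ by rw [← hyx, A.symm_apply_apply]; exact hy,
      fun h ↦ ⟨A.symm x, h, A.apply_symm_apply x⟩⟩
  refine ⟨fun t _ ↦ subset_univ _, ⟨(fun p : EuclideanSpace ℝ (Fin (n + 1)) × ℝ ↦ (A.symm p.1, p.2)) ⁻¹' C,
    hC.preimage ((A.symm.continuous.comp continuous_fst).prodMk continuous_snd), ?_⟩, ?_⟩
  · ext ⟨x, t⟩
    have key := Set.ext_iff.1 htr (A.symm x, t)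
    simp only [mem_setOf_eq, mem_inter_iff, mem_prod, mem_univ, true_and, mem_preimage] at key ⊢
    rw [hmem]
    exact key
  · intro a b hab hI N' _ _ _ F' ν' hF' _ hdis t ht
    have hflow := hF'.isometry_comp A.symm
    have hdis' : Disjoint (range fun y ↦ A.symm (F' a y)) (K a) := by
      refine Set.disjoint_left.2 ?_
      rintro _ ⟨y, rfl⟩ hm
      exact Set.disjoint_left.1 hdis (mem_range_self y) (hmem.2 hm)
    have key := havoid hab hI N' (fun t y ↦ A.symm (F' t y)) (fun t y ↦ A.symm (ν' t y)) hflow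
      (fun _ _ ↦ subset_univ _) hdis' t ht
    refine Set.disjoint_left.2 ?_
    rintro _ ⟨y, rfl⟩ hm
    exact Set.disjoint_left.1 key (mem_range_self y) (hmem.1 hm)

/-- **The level set flow commutes with linear isometries**: `F_t(A(K₀)) = A(F_t(K₀))`
(uniqueness of the biggest flow). [cite: White2000, §2] -/
theorem levelSetFlow_image_isometry (K₀ : Set (EuclideanSpace ℝ (Fin (n + 1)))) (t : ℝ) :
    levelSetFlow (euclideanMetric (EuclideanSpace ℝ (Fin (n + 1)))) (A '' K₀) t =
      A '' levelSetFlow (euclideanMetric (EuclideanSpace ℝ (Fin (n + 1)))) K₀ t := by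
  -- one inclusion for every isometry, applied to `A` and to `A⁻¹`
  have half : ∀ (B : EuclideanSpace ℝ (Fin (n + 1)) ≃ₗᵢ[ℝ] EuclideanSpace ℝ (Fin (n + 1)))
      (K₁ : Set (EuclideanSpace ℝ (Fin (n + 1)))) (s : ℝ),
      B '' levelSetFlow (euclideanMetric (EuclideanSpace ℝ (Fin (n + 1)))) K₁ s ⊆
        levelSetFlow (euclideanMetric (EuclideanSpace ℝ (Fin (n + 1)))) (B '' K₁) s := by
    intro B K₁ s
    rintro _ ⟨x, ⟨hs, K, hK, hK0, hxK⟩, rfl⟩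
    exact subset_levelSetFlow (hK.image_isometry B) (image_mono hK0) hs (mem_image_of_mem B hxK)
  refine Subset.antisymm ?_ (half A K₀ t)
  intro x hx
  have h := half A.symm (A '' K₀) t (mem_image_of_mem A.symm hx)
  have hK : A.symm '' (A '' K₀) = K₀ := by
    rw [← image_comp]
    have hid : (⇑A.symm ∘ ⇑A) = id := funext fun y ↦ A.symm_apply_apply y
    rw [hid, image_id]
  rw [hK] at h
  exact ⟨A.symm x, h, A.apply_symm_apply x⟩

/-- **Symmetric sets have symmetric level set flows**: if `A(K₀) = K₀` for a linear isometry
`A` then `A(F_t(K₀)) = F_t(K₀)` for all `t`. [cite: White2000, §2] -/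
theorem levelSetFlow_image_eq_self {K₀ : Set (EuclideanSpace ℝ (Fin (n + 1)))} (hA : A '' K₀ = K₀)
    (t : ℝ) :
    A '' levelSetFlow (euclideanMetric (EuclideanSpace ℝ (Fin (n + 1)))) K₀ t =
      levelSetFlow (euclideanMetric (EuclideanSpace ℝ (Fin (n + 1)))) K₀ t := by
  rw [← levelSetFlow_image_isometry A K₀ t, hA]

/-- **Weak set flows of `ℝⁿ⁺¹` are invariant under translations** (`IsClassicalMCF.add_const` for
the test flows). [cite: HershkovitsWhite2019, Appendix Def. 19] -/
theorem IsWeakSetFlowIn.image_add_const (v : EuclideanSpace ℝ (Fin (n + 1))) {I : Set ℝ}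
    {K : ℝ → Set (EuclideanSpace ℝ (Fin (n + 1)))}
    (hK : IsWeakSetFlowIn (euclideanMetric (EuclideanSpace ℝ (Fin (n + 1)))) univ I K) :
    IsWeakSetFlowIn (euclideanMetric (EuclideanSpace ℝ (Fin (n + 1)))) univ I
      fun t ↦ (fun x ↦ x + v) '' K t := by
  obtain ⟨-, ⟨C, hC, htr⟩, havoid⟩ := hK
  have hmem : ∀ {x : EuclideanSpace ℝ (Fin (n + 1))} {S : Set (EuclideanSpace ℝ (Fin (n + 1)))},
      x ∈ (fun x ↦ x + v) '' S ↔ x - v ∈ S := fun {x S} ↦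
    ⟨fun ⟨y, hy, hyx⟩ ↦ by rw [← hyx, add_sub_cancel_right]; exact hy,
      fun h ↦ ⟨x - v, h, sub_add_cancel x v⟩⟩
  refine ⟨fun t _ ↦ subset_univ _, ⟨(fun p : EuclideanSpace ℝ (Fin (n + 1)) × ℝ ↦ (p.1 - v, p.2)) ⁻¹' C,
    hC.preimage ((continuous_fst.sub continuous_const).prodMk continuous_snd), ?_⟩, ?_⟩
  · ext ⟨x, t⟩
    have key := Set.ext_iff.1 htr (x - v, t)
    simp only [mem_setOf_eq, mem_inter_iff, mem_prod, mem_univ, true_and, mem_preimage] at key ⊢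
    rw [hmem]
    exact key
  · intro a b hab hI N' _ _ _ F' ν' hF' _ hdis t ht
    have hflow := hF'.add_const (-v)
    have hdis' : Disjoint (range fun y ↦ F' a y + -v) (K a) := by
      refine Set.disjoint_left.2 ?_
      rintro _ ⟨y, rfl⟩ hm
      have hm' : F' a y + -v ∈ K a := hm
      rw [← sub_eq_add_neg] at hm'
      exact Set.disjoint_left.1 hdis (mem_range_self y) (hmem.2 hm')
    have key := havoid hab hI N' (fun t y ↦ F' t y + -v) ν' hflow (fun _ _ ↦ subset_univ _)
      hdis' t ht
    refine Set.disjoint_left.2 ?_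
    rintro _ ⟨y, rfl⟩ hm
    refine Set.disjoint_left.1 key (mem_range_self y) ?_
    show F' t y + -v ∈ K t
    rw [← sub_eq_add_neg]
    exact hmem.1 hm

/-- **The level set flow commutes with translations**: `F_t(K₀ + v) = F_t(K₀) + v`.
[cite: White2000, §2] -/
theorem levelSetFlow_image_add_const (v : EuclideanSpace ℝ (Fin (n + 1)))
    (K₀ : Set (EuclideanSpace ℝ (Fin (n + 1)))) (t : ℝ) :
    levelSetFlow (euclideanMetric (EuclideanSpace ℝ (Fin (n + 1)))) ((fun x ↦ x + v) '' K₀) t =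
      (fun x ↦ x + v) '' levelSetFlow (euclideanMetric (EuclideanSpace ℝ (Fin (n + 1)))) K₀ t := by
  have half : ∀ (w : EuclideanSpace ℝ (Fin (n + 1))) (K₁ : Set (EuclideanSpace ℝ (Fin (n + 1))))
      (s : ℝ), (fun x ↦ x + w) '' levelSetFlow (euclideanMetric (EuclideanSpace ℝ (Fin (n + 1)))) K₁ s ⊆
        levelSetFlow (euclideanMetric (EuclideanSpace ℝ (Fin (n + 1)))) ((fun x ↦ x + w) '' K₁) s := by
    intro w K₁ s
    rintro _ ⟨x, ⟨hs, K, hK, hK0, hxK⟩, rfl⟩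
    exact subset_levelSetFlow (hK.image_add_const w) (image_mono hK0) hs (mem_image_of_mem _ hxK)
  refine Subset.antisymm ?_ (half v K₀ t)
  intro x hx
  have h := half (-v) ((fun x ↦ x + v) '' K₀) t (mem_image_of_mem _ hx)
  have hK : (fun x ↦ x + -v) '' ((fun x ↦ x + v) '' K₀) = K₀ := by
    rw [← image_comp]
    have hid : ((fun x : EuclideanSpace ℝ (Fin (n + 1)) ↦ x + -v) ∘ fun x ↦ x + v) = id :=
      funext fun y ↦ by simp [add_assoc]
    rw [hid, image_id]
  rw [hK] at h
  exact ⟨x + -v, h, by simp⟩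

end MCF

end Literature.Geometry.Riemannian

end
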